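import Literature.NumberTheory.EllipticCurves.MordellCurveThreeDescentImage
import Literature.NumberTheory.EllipticCurves.MordellCurveThreeDescentLocalConverse
import Literature.NumberTheory.EllipticCurves.MordellCurveCubicDescentLocalCompletion
import Literature.NumberTheory.EllipticCurves.MordellCurveSqrtThreeEndomorphism
import Literature.NumberTheory.EllipticCurves.ShaIsogenyProofs
import Literature.NumberTheory.NumberFields.EisensteinFieldSelmer330
import Mathlib.NumberTheory.NumberField.Completion.FinitePlace
import HarnessLib

/-!
# The `√−3`-Selmer group of `y² = x³ − 27·55²` over `ℚ(ζ₃)` is filled by rational points: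
# `Ш(E/ℚ(ζ₃))[√−3] = 0`, hence `Ш(E/ℚ(ζ₃))[3] = 0` (complete `3`-descent, Cohen–Pazuki / Jeong)

Topic `NumberTheory/EllipticCurves`. For the Mordell curve `A : y² = x³ − 81675 = x³ − 27·55²`
(`= E_D`, `D = −3c²`, `c = 165`; the `3`-isogenous partner of `A₅₅ : y² = x³ + 55²`, Jeong's family
`A_{pq}` with `p = 5`, `q = 11`, both `≡ 2 (mod 3)`) over `K3 = ℚ(ζ₃)`, we run the COMPLETE
`√−3`-descent — at the level of Selmer classes, not only of rational points — with the tree's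
genuine cohomological objects:

* the torsor classes `[C_a] ∈ H¹(K3, A)`, `a ∈ K3ˣ`, of the `μ₃`-isogeny `φ : A → A' = E_{81c²}`
  (`A' : Y² = X³ + 1485²`; `MordellCurveThreeDescent`), whose image is `ker f_*` for the complex
  multiplication `f = [√−3] ∈ End_{K3}(A)` (`MordellCurveSqrtThreeEndomorphism`,
  `MordellCurveThreeDescentImage`: `f` is onto with kernel `A[φ] = {O, (0, ±165√−3)}`);
* `f ∘ f = [−3]` (`sqrtThree_comp_self'`, the tree's argument with `σ = ` complex conjugation, here
  for `B = 165√−3` with `σB = −B`), so that `Ш(A/K3)[3] = 0` as soon as `Ш(A/K3) ∩ ker f_* = 0`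
  (`forall_mem_sha_nsmul_three_eq_zero_of_ker`);
* the local conditions NECESSARY for `[C_a] ∈ Ш` (`MordellCurveThreeDescentLocalConverse`): at every
  finite place `v`, `a ≡ δ(P_v)` modulo cubes for a `K3_v`-point `P_v` of `A'`, `δ(X, Y) = Y + 1485`;
  hence (`MordellCurveCubicDescentLocal` on the completions) `3 ∣ ord_v(a)` for `v ∤ 330` and for
  `v = λ` (`2δ-parameter = 2970 = 2·3³·5·11`, `ord_λ = 6`), and `χ₂(a) = 0` for the cubic residue
  character of the `2`-unit part, extended to `K3_2` by density
  (`MordellCurveCubicDescentLocalCompletion`; `1485` is a `2`-unit);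
* whence `a = ±ζ^0 λ^0 2^k 5^l 11^m w³` (`EisensteinFieldSelmer330`): **the `√−3`-Selmer group of
  `A/K3` has at most `27` elements, all of them classes of the rational numbers `2^k 5^l 11^m`** —
  and each of these IS a descent value: `δ(−54, 1431) = 2916 = 4·9³`, `δ(99, 1782) = 3267 = 27·11²`,
  `δ(0, 1485) = 2970 = 27·110` on `A'(ℚ)` generate `⟨[2], [5], [11]⟩`;
* so every `[C_a] ∈ Ш(A/K3)` vanishes (`MordellCurveThreeDescentImage`:
  `eq_zero_of_mem_sha_of_galH1Map_eq_zero`), **`Ш(A/K3) ∩ ker f_* = 0`**, and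
  **`Ш(A/K3)[3] = 0`** (`XCubeSub81675.forall_mem_sha_three_nsmul_eq_zero`).

This is the Selmer-group computation of Cohen–Pazuki's `3`-descent (Acta Arith. 2009, Thm. 2.1/
§5) for this curve in the tree's language, for the family treated by Jeong (Proc. Japan Acad. 2019,
§3: `Sel_φ(A_{pq}) ⊆ ⟨2, p, q⟩`, `ζ₃ ∉ Sel_{φ'}`): here both Selmer groups are read jointly over
`K3 ∋ √−3`, where `φ' ∘ φ` becomes `f² = −3`. The descent to `Ш(A/ℚ)[3] = 0` and the rank
(`= 2`) are in the sequel `XCubeSub81675ShaThree.lean`.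

## References

* [CohenPazuki2009] H. Cohen, F. Pazuki, *Elementary 3-descent with a 3-isogeny*, Acta Arith. 140
  (2009) 369–404, Thm. 2.1, §5 (local solubility at `p = 3`, `p = 2`, `p ∣ D`).
* [Jeong2019RankExactlyTwoII] K. Jeong, *Infinitely many elliptic curves of rank exactly two II*,
  Proc. Japan Acad. Ser. A 95 (2019) 53–57, §3, Lemma 3.3, Prop. 3.5.
* [SilvermanAEC2009] J. H. Silverman, *The Arithmetic of Elliptic Curves*, 2nd ed., Thm. X.4.2,
  Prop. X.4.9, Exercise 10.9.
* [Cassels1964ArithmeticVI] J. W. S. Cassels, J. reine angew. Math. 214/215 (1964) 65–70, p. 65.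

## Design

Theorems only. `A` is presented as `mordellCurve (BA ^ 2)` with `BA = 165 θ` (`θ = 2ζ + 1 = √−3 ∈ K3`)
so that the tree's `SqrtThree.sqrtThree` (which wants `Y² = X³ + B²`) applies literally, and as
`mordellCurve D` with `D = BA ^ 2 = −3 · 165²` for the torsor classes (`hD165`). The identification
with the base change of `y² = x³ − 81675` from `ℚ` is done in the sequel.
-/

noncomputable section

open scoped Classical WithZero

open WeierstrassCurve IsDedekindDomain IsDedekindDomain.HeightOneSpectrum NumberField
open WithZero (log exp)
open Literature.NumberTheory.NumberFields Literature.NumberTheory.NumberFields.K3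
open Literature.NumberTheory.GaloisRepresentations

universe u

namespace Literature.NumberTheory.EllipticCurves

/-! ## §0 Generic complements: `f ∘ f = −3` for `B` with `σB = −B`; the `Ш[3]` skeleton -/

namespace SqrtThree

variable {F : Type u} [Field F] [CharZero F] {B θ : F}

/-- **`ψ ∘ ψ = [−3]` on `E'_B(F̄)`, variant**: as the tree's `sqrtThree_comp_self`, but for an
automorphism `σ` of `F̄` with `σ(θ) = −θ` and `σ(B) = −B` (so that `σ` still fixes the curve
`Y² = X³ + B²` and Vélu's polynomials, which only involve `B²`) — the case `B ∈ F θ` of a curve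
`Y² = X³ − 3c²` written as `Y² = X³ + (cθ)²` over `F ∋ θ`. [cite: SilvermanAEC2009, Cor. III.6.3] -/
theorem sqrtThree_comp_self' (σ : AlgebraicClosure F ≃+* AlgebraicClosure F)
    (hσθ : σ (algebraMap F _ θ) = -algebraMap F _ θ) (hσB : σ (algebraMap F _ B) = -algebraMap F _ B)
    (hB : B ≠ 0) (hθ : θ ^ 2 = -3) (P : (mordellCurve (B ^ 2)).geomPoints) :
    sqrtThree hB hθ (sqrtThree hB hθ P) = -((3 : ℤ) • P) := by
  haveI := isElliptic_mordellCurve (pow_ne_zero 2 hB)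
  have hσB2 : σ (algebraMap F (AlgebraicClosure F) B ^ 2) = algebraMap F (AlgebraicClosure F) B ^ 2 := by
    rw [map_pow, hσB, neg_sq]
  have hcurve : ((mordellCurve (B ^ 2)).baseChange (AlgebraicClosure F)).map σ.toRingHom =
      (mordellCurve (B ^ 2)).baseChange (AlgebraicClosure F) := by
    rw [mordellCurve_baseChange, map_mordellCurve, map_pow, RingEquiv.toRingHom_eq_coe,
      RingHom.coe_coe, hσB2]
  have hC : Polynomial.C (σ (algebraMap F (AlgebraicClosure F) B)) ^ 2 =
      Polynomial.C (algebraMap F (AlgebraicClosure F) B) ^ 2 := by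
    rw [hσB, Polynomial.C_neg, neg_sq]
  have hU : ((veluFormula B).U.map (algebraMap F (AlgebraicClosure F))).map σ.toRingHom =
      (veluFormula B).U.map (algebraMap F (AlgebraicClosure F)) := by
    have h4 : σ (algebraMap F (AlgebraicClosure F) 4) = algebraMap F (AlgebraicClosure F) 4 := by
      rw [map_ofNat, map_ofNat]
    simp [veluFormula_U, h4, hC]
  have hS : ((veluFormula B).S.map (algebraMap F (AlgebraicClosure F))).map σ.toRingHom =
      (veluFormula B).S.map (algebraMap F (AlgebraicClosure F)) := by
    have h8 : σ (algebraMap F (AlgebraicClosure F) 8) = algebraMap F (AlgebraicClosure F) 8 := by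
      rw [map_ofNat, map_ofNat]
    simp [veluFormula_S, h8, hC]
  have h := IsogenyFormula.sqrtEndo_comp_self (veluFormula B) (isTwistBy B) θ hθ (theta_ne_zero hθ)
    σ hσθ hcurve hU (map_sigma_h σ) hS (isCoprime_U_h hB) P
  have hdeg : (veluFormula B).U.natDegree = 3 := by
    rw [veluFormula_U, Polynomial.natDegree_X_pow_add_C]
  rw [hdeg] at h
  exact h

/-- **The kernel of `[√−3]` on `E'_B(F̄)` is `{O, (0, ±B)}`**: off `X = 0` the value is an affine
point (`sqrtEndo_some`; the exceptional polynomial of the twisted formula is `θX`).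
[cite: SilvermanAEC2009, Remark III.4.13.3] -/
theorem sqrtThree_eq_zero_imp (hB : B ≠ 0) (hθ : θ ^ 2 = -3) {x y : AlgebraicClosure F}
    (hxy : ((mordellCurve (B ^ 2)).baseChange (AlgebraicClosure F)).toAffine.Nonsingular x y)
    (h0 : sqrtThree hB hθ (Affine.Point.some x y hxy) = 0) : x = 0 := by
  haveI := isElliptic_mordellCurve (pow_ne_zero 2 hB)
  by_contra hx
  have hh : ((veluFormula B).twistGeom (isTwistBy B) θ hθ (theta_ne_zero hθ)).h.eval x ≠ 0 := by
    rw [Ne, IsogenyFormula.twistGeom_h_eval_eq_zero_iff, veluFormula_h, Polynomial.map_X,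
      Polynomial.eval_X]
    exact hx
  have hval := IsogenyFormula.sqrtEndo_some (veluFormula B) (isTwistBy B) θ hθ (theta_ne_zero hθ) hxy hh
  change sqrtThree hB hθ (Affine.Point.some x y hxy) = _ at hval
  rw [h0] at hval
  exact Affine.Point.some_ne_zero _ hval.symm

end SqrtThree

section Skeleton

variable {K : Type u} [Field K] [NumberField K] {W : WeierstrassCurve K} [W.IsElliptic]

omit [NumberField K] [W.IsElliptic] in
/-- `H¹` of an endomorphism acting as the scalar `−n` on points kills the `n`-torsion classes
(`f_* [a] = [−n a] = −n [a]`). [cite: SilvermanAEC2009, Thm. X.4.2(a)] -/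
theorem galH1Map_eq_zero_of_forall_eq_neg_smul (f : W.geomPoints →+ W.geomPoints)
    (hf : ∀ (σ : Field.absoluteGaloisGroup K) (P : W.geomPoints), f (σ • P) = σ • f P)
    (n : ℕ) (h : ∀ P : W.geomPoints, f P = -((n : ℤ) • P)) (c : W.galH1) (hc : n • c = 0) :
    galH1Map f hf c = 0 := by
  obtain ⟨a, rfl⟩ := oneCocycleClass_surjective _ c
  rw [galH1Map_oneCocycleClass]
  have key : contOneCocycles.push f hf a = (-(n : ℤ)) • a := by
    apply Subtype.ext
    ext σ
    rw [contOneCocycles.push_apply, h, Submodule.coe_smul, ContinuousMap.smul_apply, neg_smul]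
  rw [key, oneCocycleClass_smul, neg_smul, neg_eq_zero, Nat.cast_smul_eq_nsmul]
  exact hc

omit [W.IsElliptic] in
/-- **The `Ш[3]` skeleton.** If an isogeny `g : E → E` over a number field satisfies `g ∘ g = [−3]`
on `E(K̄)` and no non-zero class of `Ш(E/K)` is killed by `g_*`, then `Ш(E/K)` has no `3`-torsion:
for `c ∈ Ш` with `3c = 0`, `g_*(g_* c) = −3c = 0`, so `g_* c ∈ Ш ∩ ker g_* = 0`, so
`c ∈ Ш ∩ ker g_* = 0` (`g_*` preserves `Ш`: every isogeny has local points maps).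
[cite: SilvermanAEC2009, Thm. X.4.2(a)] -/
theorem forall_mem_sha_nsmul_three_eq_zero_of_ker (g : Isogeny W W)
    (hgg : ∀ P : W.geomPoints, g (g P) = -((3 : ℤ) • P))
    (hker : ∀ c ∈ W.sha, galH1Map g.toAddMonoidHom g.equivariant c = 0 → c = 0) :
    ∀ c ∈ W.sha, 3 • c = 0 → c = 0 := by
  intro c hc h3
  have hloc := g.hasLocalPointsMaps_toAddMonoidHom
  set d := galH1Map g.toAddMonoidHom g.equivariant c with hd
  have hdsha : d ∈ W.sha := galH1Map_mem_sha g.toAddMonoidHom g.equivariant hloc hc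
  have hgd : galH1Map g.toAddMonoidHom g.equivariant d = 0 := by
    rw [hd, galH1Map_galH1Map]
    have hcomp : ∀ P : W.geomPoints, (g.toAddMonoidHom.comp g.toAddMonoidHom) P = -(((3 : ℕ) : ℤ) • P) := by
      intro P
      rw [AddMonoidHom.comp_apply]
      exact hgg P
    exact galH1Map_eq_zero_of_forall_eq_neg_smul _ _ 3 hcomp _ h3
  have hd0 : d = 0 := hker d hdsha hgd
  exact hker c hc hd0

end Skeleton

/-! ## §1 The curve `A : y² = x³ − 27·55²` over `K3`, its CM by `√−3`, and the torsor data -/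

namespace XCubeSub81675

/-- `B_A = 165 θ`, `θ = √−3 ∈ K3`: `A : Y² = X³ + B_A² = X³ − 81675`. [cite: Jeong2019RankExactlyTwoII, §3] -/
theorem hBA : (165 * theta : K3) ≠ 0 :=
  mul_ne_zero (by norm_num) fun h => by
    have := theta_sq; rw [h] at this; norm_num at this

/-- `A = E_D` with `D = B_A² = −3 · 165²`. [cite: Jeong2019RankExactlyTwoII, §3] -/
theorem hD165 : (165 * theta : K3) ^ 2 = -3 * 165 ^ 2 := by
  rw [mul_pow, theta_sq]; ring

/-- `c = 165 ≠ 0` in `K3` (the parameter of `A = E_{−3c²}`). [cite: Jeong2019RankExactlyTwoII, §3] -/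
theorem hc165 : (165 : K3) ≠ 0 := by norm_num

/-- **`f ∘ f = [−3]`** on `A(K̄)` (complex conjugation `σ` of `K̄3` has `σθ = −θ`, `σ B_A = −B_A`).
[cite: SilvermanAEC2009, Cor. III.6.3] -/
theorem f_comp_self (P : (mordellCurve ((165 * theta : K3) ^ 2)).geomPoints) :
    (SqrtThree.sqrtThree hBA theta_sq) ((SqrtThree.sqrtThree hBA theta_sq) P) = -((3 : ℤ) • P) := by
  refine SqrtThree.sqrtThree_comp_self' conjBar conjBar_theta ?_ hBA theta_sq P
  rw [map_mul, map_mul, conjBar_theta, mul_neg]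
  congr 1
  have : ((165 : ℚ) : K3) = 165 := by norm_num
  rw [← this, conjBar_ratCast]

/-- **`ker f ⊆ A[φ] = {O, ±T}`**, `T = (0, 165√−3)` the kernel point of the `μ₃`-descent.
[cite: CohenPazuki2009, Thm. 2.1] -/
theorem f_ker (P : (mordellCurve ((165 * theta : K3) ^ 2)).geomPoints) (h0 : (SqrtThree.sqrtThree hBA theta_sq) P = 0) :
    P = 0 ∨ P = MordellDescent.torsT hc165 hD165 ∨ P = -MordellDescent.torsT hc165 hD165 := by
  rcases P with _ | ⟨x, y, hxy⟩
  · exact Or.inl rfl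
  · have hx : x = 0 := SqrtThree.sqrtThree_eq_zero_imp hBA theta_sq hxy h0
    exact Or.inr ((MordellDescent.isVeluThreePair_mordell hc165 hD165).some_eq_T_or hxy hx)

/-- `f` is onto `A(K̄)` (every isogeny of elliptic curves is). [cite: SilvermanAEC2009, Thm. II.2.3] -/
theorem f_surjective : Function.Surjective (SqrtThree.sqrtThree hBA theta_sq).toAddMonoidHom := by
  haveI := isElliptic_mordellCurve (pow_ne_zero 2 hBA)
  exact Isogeny.surjective _

/-! ## §2 The descent values of the rational points of `A' : Y² = X³ + 1485²` generate `⟨[2],[5],[11]⟩` -/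

/-- The codomain of the `μ₃`-descent: `A' = E_{81·165²} : Y² = X³ + 1485²`. [cite: Jeong2019RankExactlyTwoII, §3] -/
theorem hA' : (81 : K3) * 165 ^ 2 ≠ 0 := by norm_num

/-- `cubeClass` is multiplicative on powers. [folklore] -/
private theorem cubeClass_pow {F : Type u} [Field F] {a : F} (ha : a ≠ 0) (n : ℕ) :
    MordellDescent.cubeClass (a ^ n) = MordellDescent.cubeClass a ^ n := by
  induction n with
  | zero => rw [pow_zero, pow_zero, MordellDescent.cubeClass_one]
  | succ n ih => rw [pow_succ, pow_succ, MordellDescent.cubeClass_mul (pow_ne_zero _ ha) ha, ih]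

/-- The subgroup of `K3ˣ/K3ˣ³` generated by the descent values `[δ(P)]`, `P ∈ A'(K3)`
(`δ(X, Y) = Y + 1485`, the tree's `phiDescent 165`). Notation-free: we prove memberships in it.
The points `(−54, 1431)`, `(99, 1782)`, `(0, 1485)` of `A'(ℚ)` give `δ = 2916 = 4·9³`,
`3267 = 121·27`, `2970 = 110·27`, whence `[2] = [4]²`, `[11] = [121]²`, `[5] = [110][4][121]`
(`110·4·121 = 5·22³`). [cite: Jeong2019RankExactlyTwoII, §3] -/
theorem cubeClass_two_five_eleven_mem :
    MordellDescent.cubeClass (2 : K3) ∈ Subgroup.closure (Set.range fun P : (mordellCurve (81 * (165 : K3) ^ 2)).toAffine.Point =>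
        MordellDescent.cubeClass (MordellDescent.phiDescent (165 : K3) P)) ∧
      MordellDescent.cubeClass (5 : K3) ∈ Subgroup.closure (Set.range fun P : (mordellCurve (81 * (165 : K3) ^ 2)).toAffine.Point =>
        MordellDescent.cubeClass (MordellDescent.phiDescent (165 : K3) P)) ∧
      MordellDescent.cubeClass (11 : K3) ∈ Subgroup.closure (Set.range fun P : (mordellCurve (81 * (165 : K3) ^ 2)).toAffine.Point =>
        MordellDescent.cubeClass (MordellDescent.phiDescent (165 : K3) P)) := by
  set H := Subgroup.closure (Set.range fun P : (mordellCurve (81 * (165 : K3) ^ 2)).toAffine.Point =>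
        MordellDescent.cubeClass (MordellDescent.phiDescent (165 : K3) P)) with hH
  -- the three rational points and their descent values
  have hP1 : (mordellCurve (81 * (165 : K3) ^ 2)).toAffine.Nonsingular (-54) 1431 :=
    nonsingular_mordellCurve_of_equation hA' ((mordellCurve_equation_iff _ _ _).mpr (by norm_num))
  have hP2 : (mordellCurve (81 * (165 : K3) ^ 2)).toAffine.Nonsingular 99 1782 :=
    nonsingular_mordellCurve_of_equation hA' ((mordellCurve_equation_iff _ _ _).mpr (by norm_num))
  have hT : (mordellCurve (81 * (165 : K3) ^ 2)).toAffine.Nonsingular 0 1485 :=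
    nonsingular_mordellCurve_of_equation hA' ((mordellCurve_equation_iff _ _ _).mpr (by norm_num))
  have hδ1 : MordellDescent.phiDescent (165 : K3) (Affine.Point.some _ _ hP1) = 4 * 9 ^ 3 := by
    rw [MordellDescent.phiDescent_some, if_neg (by norm_num)]; norm_num
  have hδ2 : MordellDescent.phiDescent (165 : K3) (Affine.Point.some _ _ hP2) = 121 * 3 ^ 3 := by
    rw [MordellDescent.phiDescent_some, if_neg (by norm_num)]; norm_num
  have hδT : MordellDescent.phiDescent (165 : K3) (Affine.Point.some _ _ hT) = 110 * 3 ^ 3 := by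
    rw [MordellDescent.phiDescent_some, if_neg (by norm_num)]; norm_num
  have hmem : ∀ P : (mordellCurve (81 * (165 : K3) ^ 2)).toAffine.Point,
      MordellDescent.cubeClass (MordellDescent.phiDescent (165 : K3) P) ∈ H := fun P =>
    Subgroup.subset_closure ⟨P, rfl⟩
  have h4 : MordellDescent.cubeClass (4 : K3) ∈ H := by
    have := hmem (Affine.Point.some _ _ hP1)
    rwa [hδ1, MordellDescent.cubeClass_mul_pow_three (by norm_num) (by norm_num)] at this
  have h121 : MordellDescent.cubeClass (121 : K3) ∈ H := by
    have := hmem (Affine.Point.some _ _ hP2)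
    rwa [hδ2, MordellDescent.cubeClass_mul_pow_three (by norm_num) (by norm_num)] at this
  have h110 : MordellDescent.cubeClass (110 : K3) ∈ H := by
    have := hmem (Affine.Point.some _ _ hT)
    rwa [hδT, MordellDescent.cubeClass_mul_pow_three (by norm_num) (by norm_num)] at this
  have h2 : MordellDescent.cubeClass (2 : K3) ∈ H := by
    have e : MordellDescent.cubeClass (2 : K3) = MordellDescent.cubeClass (4 : K3) * MordellDescent.cubeClass (4 : K3) := by
      rw [← MordellDescent.cubeClass_mul (by norm_num) (by norm_num),
        show (4 : K3) * 4 = 2 * 2 ^ 3 by norm_num, MordellDescent.cubeClass_mul_pow_three (by norm_num) (by norm_num)]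
    rw [e]; exact H.mul_mem h4 h4
  have h11 : MordellDescent.cubeClass (11 : K3) ∈ H := by
    have e : MordellDescent.cubeClass (11 : K3) = MordellDescent.cubeClass (121 : K3) * MordellDescent.cubeClass (121 : K3) := by
      rw [← MordellDescent.cubeClass_mul (by norm_num) (by norm_num),
        show (121 : K3) * 121 = 11 * 11 ^ 3 by norm_num, MordellDescent.cubeClass_mul_pow_three (by norm_num) (by norm_num)]
    rw [e]; exact H.mul_mem h121 h121
  have h5 : MordellDescent.cubeClass (5 : K3) ∈ H := by
    have e : MordellDescent.cubeClass (5 : K3) =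
        MordellDescent.cubeClass (110 : K3) * MordellDescent.cubeClass (4 : K3) * MordellDescent.cubeClass (121 : K3) := by
      rw [← MordellDescent.cubeClass_mul (by norm_num) (by norm_num),
        ← MordellDescent.cubeClass_mul (by norm_num) (by norm_num),
        show (110 : K3) * 4 * 121 = 5 * 22 ^ 3 by norm_num, MordellDescent.cubeClass_mul_pow_three (by norm_num) (by norm_num)]
    rw [e]; exact H.mul_mem (H.mul_mem h110 h4) h121
  exact ⟨h2, h5, h11⟩

/-- **Every class `[2^k 5^l 11^m]` is a descent value of `A'(K3)`** (indeed of `A'(ℚ)`).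
[cite: Jeong2019RankExactlyTwoII, §3] -/
theorem cubeClass_two_five_eleven_pow_mem (k l m : ℕ) :
    MordellDescent.cubeClass (((2 ^ k * 5 ^ l * 11 ^ m : ℚ)) : K3) ∈
      Subgroup.closure (Set.range fun P : (mordellCurve (81 * (165 : K3) ^ 2)).toAffine.Point =>
        MordellDescent.cubeClass (MordellDescent.phiDescent (165 : K3) P)) := by
  obtain ⟨h2, h5, h11⟩ := cubeClass_two_five_eleven_mem
  have hcast : (((2 ^ k * 5 ^ l * 11 ^ m : ℚ)) : K3) = (2 : K3) ^ k * 5 ^ l * 11 ^ m := by push_cast; ring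
  rw [hcast, MordellDescent.cubeClass_mul (mul_ne_zero (pow_ne_zero _ two_ne_zero) (pow_ne_zero _ (by norm_num)))
      (pow_ne_zero _ (by norm_num)),
    MordellDescent.cubeClass_mul (pow_ne_zero _ two_ne_zero) (pow_ne_zero _ (by norm_num)),
    cubeClass_pow two_ne_zero, cubeClass_pow (by norm_num), cubeClass_pow (by norm_num)]
  exact Subgroup.mul_mem _ (Subgroup.mul_mem _ (Subgroup.pow_mem _ h2 k) (Subgroup.pow_mem _ h5 l))
    (Subgroup.pow_mem _ h11 m)

/-! ## §3 The local conditions necessary for `[C_a] ∈ Ш(A/K3)` -/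

/-- The valuation of `K3_v` restricts to `v` on `K3`. [folklore] -/
private theorem v_algebraMap (v : HeightOneSpectrum (𝓞 K3)) (x : K3) :
    Valued.v (algebraMap K3 (v.adicCompletion K3) x) = v.valuation K3 x :=
  valuedAdicCompletion_eq_valuation' v x

/-- `2970 = 2·3³·5·11 ∉ 𝔭_v` for `v ∤ 330`. [folklore] -/
private theorem natCast_2970_not_mem {v : HeightOneSpectrum (𝓞 K3)} (hv : (330 : 𝓞 K3) ∉ v.asIdeal) :
    ((2970 : ℕ) : 𝓞 K3) ∉ v.asIdeal := by
  intro h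
  have h330 : (330 : 𝓞 K3) = 3 * 110 := by norm_num
  have h' : (3 : 𝓞 K3) * (3 * 330) ∈ v.asIdeal := by
    have e : (3 : 𝓞 K3) * (3 * 330) = ((2970 : ℕ) : 𝓞 K3) := by norm_num
    rw [e]; exact h
  have h3 : (3 : 𝓞 K3) ∈ v.asIdeal → False := fun h3 =>
    hv (by rw [h330]; exact v.asIdeal.mul_mem_right _ h3)
  rcases v.isPrime.mem_or_mem h' with h3' | h''
  · exact h3 h3'
  · rcases v.isPrime.mem_or_mem h'' with h3' | h330'
    · exact h3 h3'
    · exact hv h330'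

/-- `χ₂` is a level-one residue character for `val₂` on `K3` (as in the tree's cubic-twist files).
[cite: IrelandRosen1990, Ch. 9 §3] -/
private theorem isResidueChar_chi2' : MordellDescent.IsResidueChar (val prime_natCast_two) chi2 :=
  ⟨fun hx hy ↦ chi_mul _ cubicChar_mul_two hx hy, fun h ↦ chi_eq_of_val_sub_lt _ h,
    chi_neg_one _ cubicChar_ratCast_two⟩

/-- In a completion `L` of `K3`: `algebraMap 165 = 165`, so `2 · (9 · 165) = 2970` and `9 · 165 = 1485`
read through `algebraMap`. [folklore] -/
private theorem algebraMap_facts (L : Type) [Field L] [Algebra K3 L] :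
    (9 : L) * algebraMap K3 L 165 = algebraMap K3 L ((1485 : ℕ) : K3) ∧
      (2 : L) * (9 * algebraMap K3 L 165) = algebraMap K3 L ((2970 : ℕ) : K3) ∧
      (9 : L) * algebraMap K3 L 165 ≠ 0 := by
  have h165 : algebraMap K3 L 165 = 165 := map_ofNat _ 165
  refine ⟨?_, ?_, ?_⟩
  · rw [h165, map_natCast]; norm_num
  · rw [h165, map_natCast]; norm_num
  · rw [h165]
    haveI : CharZero L := charZero_of_injective_algebraMap (algebraMap K3 L).injective
    norm_num

section Local

variable {a : K3} (ha : a ≠ 0)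
  (hsha : MordellDescent.torsorClass hc165 hD165 ha ∈ (mordellCurve ((165 * theta : K3) ^ 2)).sha)
include hsha

/-- **At the places `v ∤ 330`: `3 ∣ ord_v(a)`.** Necessity gives `a ≡ δ(P_v)` modulo cubes for a
`K3_v`-point `P_v` of `A'`, and `3 ∣ ord_v(δ(P_v))` as `ord_v(2·1485) = 0`
(`three_dvd_log_cubicDescent_of_dvd` on the completion). [cite: CohenPazuki2009, Thm. 2.1] -/
theorem three_dvd_log_valuation_of_sha (v : HeightOneSpectrum (𝓞 K3)) (hv : (330 : 𝓞 K3) ∉ v.asIdeal) :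
    (3 : ℤ) ∣ log (v.valuation K3 a) := by
  set L := v.adicCompletion K3 with hL
  haveI : CharZero L := charZero_of_injective_algebraMap (algebraMap K3 L).injective
  obtain ⟨P, w, hw, hδ⟩ :=
    MordellDescent.exists_phiDescent_eq_adicCompletion_of_torsorClass_mem_sha hc165 hD165 ha hsha v
  obtain ⟨-, h2970, hcL⟩ := algebraMap_facts L
  have haL : algebraMap K3 L a ≠ 0 := (map_ne_zero (algebraMap K3 L)).mpr ha
  have hW : mordellCurve (81 * algebraMap K3 L 165 ^ 2) = mordellCurve ((9 * algebraMap K3 L 165) ^ 2) := by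
    congr 1; ring
  have hv2970 : (3 : ℤ) ∣ log (Valued.v ((2 : L) * (9 * algebraMap K3 L 165))) := by
    rw [h2970, v_algebraMap, ← coe_natCast_ringOfIntegers,
      valuation_coe_eq_one v (natCast_2970_not_mem hv), WithZero.log_one]
    exact dvd_zero 3
  have key := (Valued.v (R := L)).three_dvd_log_cubicDescent_of_dvd hW hcL two_ne_zero hv2970 P
  rw [← MordellDescent.phiDescent_eq_cubicDescent, hδ, Valuation.log_map_mul _ haL (pow_ne_zero 3 hw),
    Valuation.log_map_pow, v_algebraMap] at key
  have : (3 : ℤ) ∣ log (v.valuation K3 a) + 3 * log (Valued.v w) := key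
  omega

/-- **At `λ = ζ − 1`: `3 ∣ ord_λ(a)`** (`ord_λ(2·1485) = ord_λ(27) = 6`). [cite: CohenPazuki2009, Thm. 2.1 and §5] -/
theorem three_dvd_log_vL_of_sha : (3 : ℤ) ∣ log (vL a) := by
  set v : HeightOneSpectrum (𝓞 K3) := placeOfPrime prime_lamInt with hvdef
  set L := v.adicCompletion K3 with hL
  haveI : CharZero L := charZero_of_injective_algebraMap (algebraMap K3 L).injective
  obtain ⟨P, w, hw, hδ⟩ :=
    MordellDescent.exists_phiDescent_eq_adicCompletion_of_torsorClass_mem_sha hc165 hD165 ha hsha v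
  obtain ⟨-, h2970, hcL⟩ := algebraMap_facts L
  have haL : algebraMap K3 L a ≠ 0 := (map_ne_zero (algebraMap K3 L)).mpr ha
  have hW : mordellCurve (81 * algebraMap K3 L 165 ^ 2) = mordellCurve ((9 * algebraMap K3 L 165) ^ 2) := by
    congr 1; ring
  -- `ord_λ(2970) = ord_λ(27 · 110) = 6`
  have hv2970 : (3 : ℤ) ∣ log (Valued.v ((2 : L) * (9 * algebraMap K3 L 165))) := by
    rw [h2970, v_algebraMap, show ((2970 : ℕ) : K3) = 3 ^ 3 * ((110 : ℕ) : K3) by norm_num,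
      Valuation.log_map_mul _ (by norm_num) (by norm_num), Valuation.log_map_pow]
    change (3 : ℤ) ∣ 3 * log (vL 3) + log (vL ((110 : ℕ) : K3))
    rw [vL_three, WithZero.log_exp, log_val_lam_natCast (by norm_num)]
    norm_num
  have key := (Valued.v (R := L)).three_dvd_log_cubicDescent_of_dvd hW hcL two_ne_zero hv2970 P
  rw [← MordellDescent.phiDescent_eq_cubicDescent, hδ, Valuation.log_map_mul _ haL (pow_ne_zero 3 hw),
    Valuation.log_map_pow, v_algebraMap] at key
  have : (3 : ℤ) ∣ log (vL a) + 3 * log (Valued.v w) := key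
  omega

/-- **At `2`: `χ₂(a) = 0`** for the cubic residue character of the `2`-unit part. The character
extends to the completion `K3_2` by density (`exists_isResidueChar_extension`); there it kills the
descent value `δ(P_2) ≡ a` (`IsResidueChar.apply_cubicDescent_eq_zero`: `1485` is a `2`-unit,
`ord_2(2·1485) = 1`). [cite: CohenPazuki2009, §5] [cite: Jeong2019RankExactlyTwoII, Lemma 3.4 (iii)] -/
theorem chi2_eq_zero_of_sha : chi2 a = 0 := by
  set v : HeightOneSpectrum (𝓞 K3) := placeOfPrime prime_natCast_two with hvdef
  set L := v.adicCompletion K3 with hL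
  haveI : CharZero L := charZero_of_injective_algebraMap (algebraMap K3 L).injective
  obtain ⟨P, w, hw, hδ⟩ :=
    MordellDescent.exists_phiDescent_eq_adicCompletion_of_torsorClass_mem_sha hc165 hD165 ha hsha v
  obtain ⟨χL, hχL, hχLK⟩ := isResidueChar_chi2'.exists_isResidueChar_extension (L := L)
    (fun y => v_algebraMap v y) (denseRange_algebraMap K3 v)
  obtain ⟨h1485, h2970, hcL⟩ := algebraMap_facts L
  have haL : algebraMap K3 L a ≠ 0 := (map_ne_zero (algebraMap K3 L)).mpr ha
  have hW : mordellCurve (81 * algebraMap K3 L 165 ^ 2) = mordellCurve ((9 * algebraMap K3 L 165) ^ 2) := by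
    congr 1; ring
  have R := cubicChar_ratCast_two
  have hχB : χL ((9 : L) * algebraMap K3 L 165) = 0 := by
    rw [h1485, hχLK]; exact chi_natCast _ R 1485
  have hχ2B : χL ((2 : L) * (9 * algebraMap K3 L 165)) = 0 := by
    rw [h2970, hχLK]; exact chi_natCast _ R 2970
  -- the window: `log v(2B) = −1`, `log v(B) = 0`
  have hvB : Valued.v ((9 : L) * algebraMap K3 L 165) = 1 := by
    rw [h1485, v_algebraMap]; exact val_natCast_of_not_dvd prime_natCast_two (by norm_num)
  have hv2B : Valued.v ((2 : L) * (9 * algebraMap K3 L 165)) = exp (-1) := by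
    rw [h2970, v_algebraMap, show ((2970 : ℕ) : K3) = ((2 : ℕ) : K3) * ((1485 : ℕ) : K3) by norm_num,
      Valuation.map_mul]
    change val prime_natCast_two _ * val prime_natCast_two _ = _
    rw [val_natCast_self, val_natCast_of_not_dvd prime_natCast_two (by norm_num), mul_one]
  have hwin : ∀ n : ℤ, log (Valued.v ((2 : L) * (9 * algebraMap K3 L 165))) ≤ n →
      n ≤ log (Valued.v ((9 : L) * algebraMap K3 L 165)) → (3 : ℤ) ∣ n →
      n = log (Valued.v ((9 : L) * algebraMap K3 L 165)) ∧
        Valued.v ((2 : L) * (9 * algebraMap K3 L 165)) < Valued.v ((9 : L) * algebraMap K3 L 165) := by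
    intro n h1 h2 h3
    rw [hv2B, WithZero.log_exp] at h1
    rw [hvB, WithZero.log_one] at h2 ⊢
    refine ⟨by omega, ?_⟩
    rw [hv2B, ← WithZero.exp_zero]
    exact WithZero.exp_lt_exp.mpr (by norm_num)
  have key := hχL.apply_cubicDescent_eq_zero hW hcL two_ne_zero hχB hχ2B hwin P
  rw [← MordellDescent.phiDescent_eq_cubicDescent, hδ, hχL.map_mul haL (pow_ne_zero 3 hw),
    hχL.map_pow_three hw, add_zero, hχLK] at key
  exact key

/-- **The `√−3`-Selmer box.** If `[C_a] ∈ Ш(A/K3)` then `[a] = [2^k 5^l 11^m]` in `K3ˣ/K3ˣ³` for some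
`k, l, m < 3`: normal form `a = ±ζ^i λ^j 2^k 5^l 11^m w³` (`EisensteinFieldSelmer330`) with `j = 0`
(place `λ`) and `i = 0` (`χ₂`). [cite: Jeong2019RankExactlyTwoII, Prop. 3.5] [cite: CohenPazuki2009, Thm. 2.1] -/
theorem exists_cubeClass_eq_of_sha :
    ∃ k l m : ℕ, MordellDescent.cubeClass a = MordellDescent.cubeClass (((2 ^ k * 5 ^ l * 11 ^ m : ℚ)) : K3) := by
  obtain ⟨s, i, j, k, l, m, w, hs, hi, hj, hk, hl, hm, hw, hnf⟩ :=
    exists_normal_form_330 ha (fun v hv => three_dvd_log_valuation_of_sha ha hsha v hv)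
  have hj0 : j = 0 := j_eq_zero_of_dvd_330 hs i j k l m hw hj (by rw [← hnf]; exact three_dvd_log_vL_of_sha ha hsha)
  have hi0 : i = 0 := by
    have h := chi2_eq_zero_of_sha ha hsha
    rw [hnf, hj0, pow_zero, mul_one, chi2_normalForm330 hs i k l m hw] at h
    exact Nat.eq_zero_of_dvd_of_lt ((ZMod.natCast_eq_zero_iff i 3).mp h) hi
  refine ⟨k, l, m, ?_⟩
  rw [hnf, hj0, hi0]
  exact cubeClass_normalForm330_of_i_j_eq_zero hs k l m hw

/-- **The Selmer group is filled by rational points**: `[a]` lies in the subgroup generated by the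
descent values `[δ(P)]`, `P ∈ A'(K3)`. [cite: Jeong2019RankExactlyTwoII, Prop. 3.5] -/
theorem cubeClass_mem_closure_of_sha :
    MordellDescent.cubeClass a ∈ Subgroup.closure (Set.range fun P : (mordellCurve (81 * (165 : K3) ^ 2)).toAffine.Point =>
        MordellDescent.cubeClass (MordellDescent.phiDescent (165 : K3) P)) := by
  obtain ⟨k, l, m, h⟩ := exists_cubeClass_eq_of_sha ha hsha
  rw [h]
  exact cubeClass_two_five_eleven_pow_mem k l m

end Local

/-! ## §4 `Ш(A/K3) ∩ ker [√−3]_* = 0` and `Ш(A/K3)[3] = 0` -/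

/-- **`Ш(A/ℚ(ζ₃))[√−3] = 0`**: no non-zero class of `Ш(A/K3)` is killed by `f_*`, `f = [√−3]`
(the image theorem identifies `ker f_*` with the torsor classes, whose Selmer group is filled by
rational points). [cite: CohenPazuki2009, Thm. 2.1] [cite: Jeong2019RankExactlyTwoII, Prop. 3.5] -/
theorem eq_zero_of_mem_sha_of_f (c : (mordellCurve ((165 * theta : K3) ^ 2)).galH1)
    (hc : c ∈ (mordellCurve ((165 * theta : K3) ^ 2)).sha)
    (h0 : galH1Map (SqrtThree.sqrtThree hBA theta_sq).toAddMonoidHom (SqrtThree.sqrtThree hBA theta_sq).equivariant c = 0) :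
    c = 0 :=
  MordellDescent.eq_zero_of_mem_sha_of_galH1Map_eq_zero hc165 hD165 (SqrtThree.sqrtThree hBA theta_sq).toAddMonoidHom
    (SqrtThree.sqrtThree hBA theta_sq).equivariant f_surjective f_ker (fun _ ha hsha => cubeClass_mem_closure_of_sha ha hsha) hc h0

/-- **`Ш(A/ℚ(ζ₃))[3] = 0` for `A : y² = x³ − 27·55²`**: every class of `Ш(A/K3)` killed by `3`
vanishes (`f ∘ f = [−3]` and `Ш ∩ ker f_* = 0`). A complete `3`-descent in the tree's cohomological
`Ш`. [cite: CohenPazuki2009, Thm. 2.1] [cite: Jeong2019RankExactlyTwoII, Prop. 3.5] -/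
theorem forall_mem_sha_three_nsmul_eq_zero :
    ∀ c ∈ (mordellCurve ((165 * theta : K3) ^ 2)).sha, 3 • c = 0 → c = 0 := by
  haveI : (mordellCurve ((165 * theta : K3) ^ 2)).IsElliptic := isElliptic_mordellCurve (pow_ne_zero 2 hBA)
  exact forall_mem_sha_nsmul_three_eq_zero_of_ker (SqrtThree.sqrtThree hBA theta_sq) f_comp_self eq_zero_of_mem_sha_of_f

end XCubeSub81675

end Literature.NumberTheory.EllipticCurves
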